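import Summits.QuantumFields.YangMills.Theorems.BalabanUVNodesN20FinalLevelBankedBudget

/-!
# N20 (NE7b), ITEM (c): THE SURVIVAL CONDITION AT THE CELL'S SMALLNESS WITNESSES — with the infrared coupling of `T4PersistentHistoryCount` §6 (`log g_K⁻² = 254`), print's `L = 13`,
# `p₀ = 23` (`A₀ = 1`), an eighth of `p₀(g_K)` banked per event, ANY record entropy `E ≤ 10^40` per event and ANY window `N ≤ 10^6`: `0 < survivalRate (c·p₀(g_K)) E N 13`, hence the
# two-rate ratio `r = L⁴·(e^{E}e^{−p})^{1∕N} < 1` of the banked budget — LOCATED-5 §3's regime «p₀∕N > (4∕c)·log L» is non-empty, with enormous room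

Cell `pub-ymgap`, YM-PLAN Track A (HUMAN RULING D-0062); seat `pub-ymgap-dag-n20-d` (R134 (a) N20 NE7b s3), gen 40 — director-ym №374 line (E), item (c).  `--kind proof --supports
stmt-QuantumFields-27366 --as helper` (K3⁸); COUNT-NEUTRAL; THEOREMS ONLY (0 `def`).  Companion: `…N20FinalLevelBankedBudget` (gen 40, p771116: `twoRate_uniformWindow_lt_one_iff`,
`survivalRate_banked_pos_iff`); the witnesses are those of `T4PersistentHistoryCount` §6 ∕ the cell's SMALLNESS.md §4.3 (`rate_margin_13`, `rate_condition_13`, `gamma_clause_13`).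

WHAT IS PROVED (kernel numerics; `norm_num` and `log x ≤ x − 1`).  `p0Profile_at_254` (`p0Profile 1 23 g = 254^23` when `log g⁻² = 254`), `four_log_thirteen_le` (`4·log 13 ≤ 48`), ★★
`survivalRate_pos_at_witnesses` (`1∕8 ≤ c`, `E ≤ 10^40`, `0 < N ≤ 10^6` ⇒ `0 < survivalRate (c·p0Profile 1 23 g_K) E N 13`), ★★ `twoRate_lt_one_at_witnesses` (⇒
`13⁴·(e^{E}·e^{−c·p₀(g_K)})^{1∕N} < 1`, p771116's `twoRate_uniformWindow_lt_one_iff`).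

HONEST FRAMING.  [numerics] at displayed witnesses; the witnesses are the cell's (SMALLNESS.md §4.3), not print's; that `E`, `N`, `c` are the right readings of the record entropy, the event
window and the banked fraction is READING (ID) ∕ the cell's R1 (NOT PRINTED).  Nothing of Bałaban's asserted; NE7b NOT PRINTED ∕ NOT proved; N20 NOT discharged; counts UNMOVED (typed 28∕28 ·
discharged 8∕27); one finite four-torus programme at fixed `ε` — NOT ℝ⁴, NOT OS, NOT a mass gap, NOT the Clay problem.  No `def`, no `instance`, no `notation`, no `sorry`; no cite tags.
-/

namespace YMDAG.UVSplit

open Literature.MathematicalPhysics.QuantumFieldTheory.Balaban1983to89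
open T4WeightBudget (survivalRate survivalRate_pos_iff)

/-- At the infrared witness `log g⁻² = 254` the exponent profile with `A₀ = 1`, `p₀ = 23` is `254^23`. [numerics] -/
theorem p0Profile_at_254 {g : ℝ} (hg : Real.log (g ^ 2)⁻¹ = 254) : p0Profile 1 23 g = (254 : ℝ) ^ 23 := by
  unfold p0Profile
  rw [hg, one_mul]

/-- `4·log 13 ≤ 48` (`log x ≤ x − 1`). [numerics] -/
theorem four_log_thirteen_le : 4 * Real.log 13 ≤ 48 := by
  have h := Real.log_le_sub_one_of_pos (show (0 : ℝ) < 13 by norm_num)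
  linarith

/-- ★★ **THE BANKED SURVIVAL CONDITION AT THE WITNESSES**: with `log g_K⁻² = 254`, a banked fraction `c ≥ 1∕8` of `p₀(g_K) = 254^23` per event, any record entropy `E ≤ 10^40` per event and
any window `0 < N ≤ 10^6`: `0 < survivalRate (c·p₀(g_K)) E N 13`. [numerics] -/
theorem survivalRate_pos_at_witnesses {g c E N : ℝ} (hg : Real.log (g ^ 2)⁻¹ = 254) (hc : 1 / 8 ≤ c) (hE : E ≤ 10 ^ 40) (hN0 : 0 < N)
    (hN : N ≤ 10 ^ 6) : 0 < survivalRate (c * p0Profile 1 23 g) E N 13 := by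
  rw [p0Profile_at_254 hg]
  unfold survivalRate
  have hlog := four_log_thirteen_le
  have hbig : (49 : ℝ) * 10 ^ 6 + 10 ^ 40 ≤ 1 / 8 * (254 : ℝ) ^ 23 := by norm_num
  have hcp : 1 / 8 * (254 : ℝ) ^ 23 ≤ c * (254 : ℝ) ^ 23 := mul_le_mul_of_nonneg_right hc (by positivity)
  have hdiv : 49 ≤ (c * (254 : ℝ) ^ 23 - E) / N := by
    rw [le_div_iff₀ hN0]
    nlinarith
  linarith

/-- ★★ **… HENCE THE TWO-RATE RATIO OF THE BANKED BUDGET IS BELOW ONE AT THE WITNESSES** (`d = 4`, `L = 13`, record entropy `Γ = e^{E}`, banked credit `ρ = e^{−c·p₀(g_K)}`, window `N`):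
`13⁴·(e^{E}·e^{−c·p₀(g_K)})^{1∕N} < 1` (p771116's `twoRate_uniformWindow_lt_one_iff`). [numerics] -/
theorem twoRate_lt_one_at_witnesses {g c E : ℝ} {N : ℕ} (hg : Real.log (g ^ 2)⁻¹ = 254) (hc : 1 / 8 ≤ c) (hE : E ≤ 10 ^ 40) (hN0 : 0 < N)
    (hN : (N : ℝ) ≤ 10 ^ 6) :
    (((13 : ℕ) : ℝ) ^ 4) * (Real.exp E * Real.exp (-(c * p0Profile 1 23 g))) ^ ((1 : ℝ) / N) < 1 :=
  (twoRate_uniformWindow_lt_one_iff hN0 (by norm_num)).2 (survivalRate_pos_at_witnesses hg hc hE (by exact_mod_cast hN0) hN)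

end YMDAG.UVSplit
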